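import Mathlib
import Summits.AtomisticToContinuum.Crystallization.Theorems.PhononSlackCertificatesNearFieldConvexityFlatnessOfCertificate

/-!
# Crux `NashNearField` (stmt-AtomisticToContinuum-16827), line `birth` (skeleton v10), stub `stub_nashFlatnessPaid` (I_flat on the Nash class):
# (I_flat, Nash class) from a POINTWISE FLATNESS CERTIFICATE required ONLY on the Nash class

The twin crux's landed `stub_flatnessOfCertificate` (13958, W5) derives (I_flat) for all `δ`-separated configurations from a pointwise
certificate with `r⁻⁶` transfers.  This file threads the Nash-class hypotheses of our registered stub through the same bookkeeping: if for some
`ε₁ ∈ [1/100, 1/20]`, `K ≥ 0`, `M`, every `1/3`-separated NASH, FORCE-BALANCED configuration and every `ε₁`-good `Ω` carry flatness witnesses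
`(s, G, ν, r, A, a, h)` and an antisymmetric transfer `τ`, `|τ i j| ≤ M·|x i − x j|⁻⁶`, with `2400ν_i² + 800r_i² ≤ K·(e_i − e*) + Σ_(j∈Ω) τ i j` at
every radius-8 interior site, then the registered text of `stub_nashFlatnessPaid` holds (`stub_nashFlatnessOfCertificate`).  So a certificate
that uses force balance / single-particle relocation stability as slack closes our stub alone; one valid for all configurations closes both
cruxes (via the twin's theorem + `stub_nashFlatnessPaid_of_twin`).  Proof = the twin's, verbatim at `δ = 1/3` (`fc_bookkeeping`, `stub_fluxEnvelope`,
`stub_selfSiteFloor`, `collar8_card_le`, `stub_pairCountOfCrossing`).  `[folklore]`.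
-/

noncomputable section

open scoped BigOperators
open Literature.MathematicalPhysics.StatisticalMechanics Literature.Geometry.DiscreteGeometry

namespace Summit.AtomisticToContinuum.Crystallization.Theorems.NashClassCertificatesNashNearField

open Summit.AtomisticToContinuum.Crystallization.Theorems.PhononSlackNearFieldConvexity

/-- **(I_flat on the Nash class) from a pointwise flatness certificate on the Nash class** — conclusion = the registered text of
`stub_nashFlatnessPaid` verbatim. [folklore] -/
theorem stub_nashFlatnessOfCertificate :
    (∃ ε₁ : ℝ, 1 / 100 ≤ ε₁ ∧ ε₁ ≤ 1 / 20 ∧ ∃ K : ℝ, 0 ≤ K ∧ ∃ M : ℝ, ∀ (N : ℕ) (x : Fin N → EuclideanSpace ℝ (Fin 3)), (∀ i j : Fin N, i ≠ j → 1 / 3 ≤ dist (x i) (x j)) → (∀ (i : Fin N) (y : EuclideanSpace ℝ (Fin 3)), (∀ j : Fin N, j ≠ i → y ≠ x j) → siteEnergy lennardJones x i ≤ ∑ j ∈ Finset.univ.erase i, lennardJones (dist y (x j))) → (∀ i : Fin N, ∑ j ∈ Finset.univ.erase i, (deriv lennardJones (dist (x i) (x j)) / dist (x i) (x j)) • (x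 i - x j) = 0) → ∀ Ω : Finset (Fin N), (∀ i ∈ Ω, IsTwoShellGood ε₁ (47 / 50) 1 x i) → ∃ (sW : Fin N → ℤ → ℤ) (Gw : Fin N → (EuclideanSpace ℝ (Fin 3) →L[ℝ] EuclideanSpace ℝ (Fin 3))) (νw rw : Fin N → ℝ) (Aw : Fin N → (EuclideanSpace ℝ (Fin 3) →ₗᵢ[ℝ] EuclideanSpace ℝ (Fin 3))) (aw hw : Fin N → ℝ) (τ : Fin N → Fin N → ℝ), (∀ i j, τ i j = -τ j i) ∧ (∀ i j, |τ i j| ≤ M * (dist (x i) (x j))⁻¹ ^ 6) ∧ ∀ i ∈ Ω, (∀ k : Fin N, dist (x k) (x i) ≤ 8 → k ∈ Ω) → (IsHaggSeq (sW i) ∧ 0 ≤ νw i ∧ ((∀ j : Fin N, dist (x j) (x i) ≤ 3 → ∃ m u v : ℤ, dist (x j - x i) ((Gw i) (barlowPos 1 (Real.sqrt 6 / 3) (sW i) m u v)) ≤ (νw i)) ∧ (∀ m u v : ℤ, ‖(Gw i) (barlowPos 1 (Real.sqrt 6 / 3) (sW i) m u v)‖ ≤ 3 → ∃ j : Fin N,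 dist (x j - x i) ((Gw i) (barlowPos 1 (Real.sqrt 6 / 3) (sW i) m u v)) ≤ (νw i)) ∧ (∀ p : EuclideanSpace ℝ (Fin 3), 4 / 5 * ‖p‖ ≤ ‖(Gw i) p‖ ∧ ‖(Gw i) p‖ ≤ 6 / 5 * ‖p‖)) ∧ 47 / 50 ≤ aw i ∧ aw i ≤ 1 ∧ 39 / 50 * aw i ≤ hw i ∧ hw i ≤ 17 / 20 * aw i ∧ (∀ m u v : ℤ, ‖barlowPos 1 (Real.sqrt 6 / 3) (sW i) m u v‖ ≤ 3 → dist ((Gw i) (barlowPos 1 (Real.sqrt 6 / 3) (sW i) m u v)) ((Aw i) (barlowPos (aw i) (hw i) (sW i) m u v)) < rw i)) ∧ 2400 * (νw i) ^ 2 + 800 * (rw i) ^ 2 ≤ K * ((1 / 2 : ℝ) * (∑ j ∈ Ω.erase i, lennardJones (dist (x i) (x j))) - (⨅ Q : PeriodicConfiguration 3, Q.energyPerParticle lennardJones)) + ∑ j ∈ Ω, τ i j) →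
    ∃ ε₁ : ℝ, 1 / 100 ≤ ε₁ ∧ ε₁ ≤ 1 / 20 ∧ ∃ K : ℝ, 0 ≤ K ∧ ∃ C : ℝ, ∀ (N : ℕ) (x : Fin N → EuclideanSpace ℝ (Fin 3)),
      (∀ i j : Fin N, i ≠ j → 1 / 3 ≤ dist (x i) (x j)) →
      (∀ (i : Fin N) (y : EuclideanSpace ℝ (Fin 3)), (∀ j : Fin N, j ≠ i → y ≠ x j) → siteEnergy lennardJones x i ≤ ∑ j ∈ Finset.univ.erase i, lennardJones (dist y (x j))) →
      (∀ i : Fin N, ∑ j ∈ Finset.univ.erase i, (deriv lennardJones (dist (x i) (x j)) / dist (x i) (x j)) • (x i - x j) = 0) →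
      ∀ Ω : Finset (Fin N), (∀ i ∈ Ω, IsTwoShellGood ε₁ (47 / 50) 1 x i) →
      ∃ (sW : Fin N → ℤ → ℤ) (Gw : Fin N → (EuclideanSpace ℝ (Fin 3) →L[ℝ] EuclideanSpace ℝ (Fin 3))) (νw rw : Fin N → ℝ) (Aw : Fin N → (EuclideanSpace ℝ (Fin 3) →ₗᵢ[ℝ] EuclideanSpace ℝ (Fin 3))) (aw hw : Fin N → ℝ), (∀ i ∈ Ω, (∀ k : Fin N, dist (x k) (x i) ≤ 8 → k ∈ Ω) → IsHaggSeq (sW i) ∧ 0 ≤ νw i ∧ ((∀ j : Fin N, dist (x j) (x i) ≤ 3 → ∃ m u v : ℤ, dist (x j - x i) ((Gw i) (barlowPos 1 (Real.sqrt 6 / 3) (sW i) m u v)) ≤ (νw i)) ∧ (∀ m u v : ℤ, ‖(Gw i) (barlowPos 1 (Real.sqrt 6 / 3) (sW i) m u v)‖ ≤ 3 → ∃ j : Fin N, dist (x j - x i) ((Gw i) (barlowPos 1 (Real.sqrt 6 / 3) (sW i) m u v)) ≤ (νw i)) ∧ (∀ p : EuclideanSpace ℝ (Fin 3), 4 / 5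 * ‖p‖ ≤ ‖(Gw i) p‖ ∧ ‖(Gw i) p‖ ≤ 6 / 5 * ‖p‖)) ∧ 47 / 50 ≤ aw i ∧ aw i ≤ 1 ∧ 39 / 50 * aw i ≤ hw i ∧ hw i ≤ 17 / 20 * aw i ∧ (∀ m u v : ℤ, ‖barlowPos 1 (Real.sqrt 6 / 3) (sW i) m u v‖ ≤ 3 → dist ((Gw i) (barlowPos 1 (Real.sqrt 6 / 3) (sW i) m u v)) ((Aw i) (barlowPos (aw i) (hw i) (sW i) m u v)) < rw i)) ∧ (∑ i ∈ Ω.filter (fun i => ∀ k : Fin N, dist (x k) (x i) ≤ 8 → k ∈ Ω), (2400 * (νw i) ^ 2 + 800 * (rw i) ^ 2)) ≤ K * ((∑ i ∈ Ω, (1 / 2 : ℝ) * (∑ j ∈ Ω.erase i, lennardJones (dist (x i) (x j)))) - (Ω.card : ℝ) * (⨅ Q : PeriodicConfiguration 3, Q.energyPerParticle lennardJones)) + C * (Nat.card {i : Fin N // i ∈ Ω ∧ ∃ j : Fin N, j ∉ Ω ∧ dist (x j) (x i) ≤ 4} : ℝ) := by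
  rintro ⟨ε₁, hε₁, hε₁', K, hK, M, hM⟩
  have hδ : (0 : ℝ) < 1 / 3 := by norm_num
  obtain ⟨Cp, hCp⟩ := stub_pairCountOfCrossing (1 / 3) hδ
  obtain ⟨Kc, hKcdef⟩ : ∃ Kc : ℝ, Kc = 1 + |Cp| * (17 / 4 : ℝ) ^ 4 := ⟨_, rfl⟩
  obtain ⟨L, hLdef⟩ : ∃ L : ℝ, L = K * (250 / 12 * (1 / 3 : ℝ)⁻¹ ^ 6) + 250 * |M| * (1 / 3 : ℝ)⁻¹ ^ 6 := ⟨_, rfl⟩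
  refine ⟨ε₁, hε₁, hε₁', K, hK, L * Kc, ?_⟩
  intro N x hsep hNash hFB Ω hΩ
  obtain ⟨sW, Gw, νw, rw, Aw, aw, hw, τ, hτ, hτM, hpt⟩ := hM N x hsep hNash hFB Ω hΩ
  refine ⟨sW, Gw, νw, rw, Aw, aw, hw, fun i hi hint => (hpt i hi hint).1, ?_⟩
  -- radius-8 interior and collar of `Ω`
  set I : Finset (Fin N) := Ω.filter (fun i => ∀ k : Fin N, dist (x k) (x i) ≤ 8 → k ∈ Ω) with hIdef
  set B : Finset (Fin N) := Ω.filter (fun i => ∃ j : Fin N, j ∉ Ω ∧ dist (x j) (x i) ≤ 8) with hBdef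
  rw [lc_natCard_eq]
  have hIΩ : I ⊆ Ω := Finset.filter_subset _ _
  have hBmem : ∀ i, i ∈ B ↔ i ∈ Ω ∧ i ∉ I := by
    intro i
    simp only [hBdef, hIdef, Finset.mem_filter]
    constructor
    · rintro ⟨hi, j, hj, hd⟩
      exact ⟨hi, fun h' => hj (h'.2 j hd)⟩
    · rintro ⟨hi, h'⟩
      refine ⟨hi, ?_⟩
      by_contra hne
      exact h' ⟨hi, fun j hd => by_contra fun hj => hne ⟨j, hj, hd⟩⟩
  have hdisj : Disjoint I B := by
    rw [Finset.disjoint_left]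
    intro i hiI hiB
    exact ((hBmem i).1 hiB).2 hiI
  -- the flux into the collar, by the envelope
  have hfluxIB : ∑ i ∈ I, ∑ j ∈ B, τ i j ≤ 250 * |M| * (1 / 3 : ℝ)⁻¹ ^ 6 * (B.card : ℝ) := by
    have h1 : ∑ i ∈ I, ∑ j ∈ B, τ i j ≤ ∑ i ∈ I, ∑ j ∈ B, |M| * (dist (x i) (x j))⁻¹ ^ 6 := by
      refine Finset.sum_le_sum fun i _ => Finset.sum_le_sum fun j _ => ?_
      have hb := hτM i j
      have h0 : (0 : ℝ) ≤ (dist (x i) (x j))⁻¹ ^ 6 := by positivity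
      calc τ i j ≤ |τ i j| := le_abs_self _
        _ ≤ M * (dist (x i) (x j))⁻¹ ^ 6 := hb
        _ ≤ |M| * (dist (x i) (x j))⁻¹ ^ 6 := mul_le_mul_of_nonneg_right (le_abs_self M) h0
    have h2 : ∑ i ∈ I, ∑ j ∈ B, |M| * (dist (x i) (x j))⁻¹ ^ 6 =
        |M| * ∑ i ∈ I, ∑ j ∈ B, (dist (x i) (x j))⁻¹ ^ 6 := by
      rw [Finset.mul_sum]
      refine Finset.sum_congr rfl fun i _ => ?_
      rw [Finset.mul_sum]
    have h3 := stub_fluxEnvelope N x (1 / 3) hδ hsep I B hdisj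
    have hM0 : 0 ≤ |M| := abs_nonneg M
    rw [h2] at h1
    nlinarith [h1, h3, hM0]
  -- the weighted bookkeeping (radius-8 interior), weight `2400 νw² + 800 rw²`
  have key := fc_bookkeeping
    (fun i : Fin N => 2400 * (νw i) ^ 2 + 800 * (rw i) ^ 2)
    (fun i : Fin N => (1 / 2 : ℝ) * (∑ j ∈ Ω.erase i, lennardJones (dist (x i) (x j))) - (⨅ Q : PeriodicConfiguration 3, Q.energyPerParticle lennardJones))
    τ Ω I B hK hτ hIΩ hBmem
    (fun i hi => (hpt i (hIΩ hi) (Finset.mem_filter.1 hi).2).2)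
    hfluxIB
    (fun i _ => stub_selfSiteFloor N x (1 / 3) hδ hsep Ω i)
  beta_reduce at key
  -- the collar count: `#B ≤ Kc · #∂₄Ω` (goodness is monotone in the tolerance: `Ω` is `1/20`-good)
  have hΩ' : ∀ i ∈ Ω, IsTwoShellGood (1 / 20) (47 / 50) 1 x i :=
    fun i hi => (hΩ i hi).mono hε₁' (by norm_num)
  have hcol := collar8_card_le x Ω
  have hpair := hCp N x hsep Ω hΩ' (17 / 4) (by norm_num)
  rw [lc_natCard_eq] at hpair
  set B4c : ℝ := ((Ω.filter fun i => ∃ j : Fin N, j ∉ Ω ∧ dist (x j) (x i) ≤ 4).card : ℝ) with hB4c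
  have hB40 : 0 ≤ B4c := Nat.cast_nonneg _
  have hBle : (B.card : ℝ) ≤ Kc * B4c := by
    have h1 : (B.card : ℝ) ≤ B4c + Cp * (17 / 4 : ℝ) ^ 4 * B4c := by
      have := hcol
      rw [← hBdef] at this
      linarith
    have h2 : Cp * (17 / 4 : ℝ) ^ 4 * B4c ≤ |Cp| * (17 / 4 : ℝ) ^ 4 * B4c :=
      mul_le_mul_of_nonneg_right (mul_le_mul_of_nonneg_right (le_abs_self Cp) (by positivity)) hB40
    rw [hKcdef]
    nlinarith
  have hRHS : (∑ i ∈ Ω, (1 / 2 : ℝ) * (∑ j ∈ Ω.erase i, lennardJones (dist (x i) (x j)))) -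
      (Ω.card : ℝ) * (⨅ Q : PeriodicConfiguration 3, Q.energyPerParticle lennardJones) =
      ∑ i ∈ Ω, ((1 / 2 : ℝ) * (∑ j ∈ Ω.erase i, lennardJones (dist (x i) (x j))) - (⨅ Q : PeriodicConfiguration 3, Q.energyPerParticle lennardJones)) := by
    rw [Finset.sum_sub_distrib, Finset.sum_const, nsmul_eq_mul]
  rw [hRHS]
  have hB0 : (0 : ℝ) ≤ (B.card : ℝ) := Nat.cast_nonneg _
  have hL0 : 0 ≤ L := by rw [hLdef]; positivity
  have hstep : L * (B.card : ℝ) ≤ L * (Kc * B4c) := mul_le_mul_of_nonneg_left hBle hL0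
  have hLB : L * (B.card : ℝ) = K * (250 / 12 * (1 / 3 : ℝ)⁻¹ ^ 6) * (B.card : ℝ) + 250 * |M| * (1 / 3 : ℝ)⁻¹ ^ 6 * (B.card : ℝ) := by
    rw [hLdef]; ring
  linarith [key, hstep, hLB]

end Summit.AtomisticToContinuum.Crystallization.Theorems.NashClassCertificatesNashNearField

end
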